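import Summits.KontsevichZagierPeriods.KontsevichZagierPeriods.Theorems.SoloInformedScissorsGrounding
import HarnessLib
import HarnessLib.Audit

/-!
# SoloInformed — grounding inside the scissors calculus `𝒮`, II: all cells, all coordinates (COMPACTIFICATION LEMMA, part 2 of 3)

Solo programme `solo-KontsevichZagierPeriods-informed`, session s261 (file 2 of 3).

Continuation of `SoloInformedScissorsGrounding`:

* `soloInformed_of_sub_sum_cyl_mem_scissorsRel` — cutting a volume representation along the
  cylinders over a finite partition of the base is a chain of scissors moves;
* `soloInformed_of_sub_of_mem_scissorsRel_cell` — grounding over an arbitrary cell of an adapted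
  cylindrical decomposition, by restriction to the common smooth locus `W ⊆ C` of the sections
  (open, `ℚ`-semialgebraic, `vol (C ∖ W) = 0` by `exists_isOpen_contDiffOn`), where the smooth-cell
  theorem applies; the pieces over `C ∖ W` are null;
* `soloInformed_of_sub_of_mem_scissorsRel_groundLast` / `…_groundAt` / `…_groundIter` — grounding
  the last coordinate, any coordinate (conjugating by a transposition, an `𝒮`-move), all coordinates;
* `soloInformed_exists_downset_sub_mem_scissorsRel` — **every volume representation of dimension
  `m + 1` is scissors congruent (in `𝒮`) to one whose domain is a down-set of the open positive
  orthant** — the `𝒮`-version of `KZ.exists_downset_sub_mem_relations`.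

Part 3 (`SoloInformedScissorsCompactify`) compresses the down-set onto a bounded set by ONE
volume-preserving map.

References: [Kontsevich–Zagier 2001, §1.2]; [Basu–Pollack–Roy 2006, Cor. 5.7]; tree files
`KZGroundingRelations`, `SemialgebraicGrounding`; this work (`nl-elimination.md` NF.4(3)).
-/

noncomputable section

open scoped BigOperators Topology ContDiff ENNReal

namespace Summit.KontsevichZagierPeriods.KontsevichZagierPeriods.Theorems

open Set MeasureTheory Filter
open Literature.ModelTheory.ExponentialFields
open Literature.NumberTheory.Transcendental Literature.NumberTheory.Transcendental.KZ

variable {m n : ℕ}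

/-! ### Cutting along cylinders -/

/-- **Cutting along cylinders, in `𝒮`**: if `P` is a finite partition of `ℝ^m` and `R_C` is the
volume representation `r` restricted to the cylinder `{z | init z ∈ C}` (`C ∈ P`), then
`[r] − ∑_C [R_C] ∈ 𝒮`. [Kontsevich–Zagier 2001, §1.2, rule (1); this work] -/
theorem soloInformed_of_sub_sum_cyl_mem_scissorsRel (r : IntegralRep (m + 1))
    (hr : SoloInformedIsVolRep r) (P : Finset (Set (Fin m → ℝ)))
    (hpart : Setoid.IsPartition (P : Set (Set (Fin m → ℝ))))
    (R : {C // C ∈ P} → IntegralRep (m + 1)) (hR : ∀ C, SoloInformedIsVolRep (R C))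
    (hRd : ∀ C, (R C).domain = r.domain ∩ {z | Fin.init z ∈ (C : Set (Fin m → ℝ))}) :
    of r - ∑ C ∈ P.attach, of (R C) ∈ soloInformedScissorsRel := by
  refine soloInformed_of_sub_sum_of_mem_scissorsRel P.attach R r hr (fun C _ => hR C) ?_ ?_
  · ext z
    simp only [mem_iUnion, exists_prop]
    constructor
    · intro hz
      have hcov : (Fin.init z : Fin m → ℝ) ∈ ⋃₀ (P : Set (Set (Fin m → ℝ))) := by
        rw [hpart.sUnion_eq_univ]; exact mem_univ _
      obtain ⟨C, hC, hzC⟩ := mem_sUnion.1 hcov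
      refine ⟨⟨C, hC⟩, Finset.mem_attach _ _, ?_⟩
      rw [hRd]
      exact ⟨hz, hzC⟩
    · rintro ⟨C, -, hz⟩
      rw [hRd] at hz
      exact hz.1
  · intro C _ C' _ hne
    have hne' : (C : Set (Fin m → ℝ)) ≠ C' := fun h => hne (Subtype.ext h)
    have hdisj : Disjoint (C : Set (Fin m → ℝ)) C' := hpart.pairwiseDisjoint C.2 C'.2 hne'
    have : (R C).domain ∩ (R C').domain = ∅ := by
      rw [hRd, hRd]
      ext z
      simp only [mem_inter_iff, mem_setOf_eq, mem_empty_iff_false, iff_false, not_and, and_imp]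
      intro _ hzC _ hzC'
      exact hdisj.ne_of_mem hzC hzC' rfl
    rw [this, measure_empty]

/-! ### Grounding over an arbitrary cell -/

/-- **Grounding over one cell, in `𝒮`** (general cell): restrict to the common smooth locus `W ⊆ C`
of the sections (open, `ℚ`-semialgebraic, `vol (C ∖ W) = 0` by `exists_isOpen_contDiffOn`), where
`soloInformed_of_sub_of_mem_scissorsRel_smoothCell` applies; the pieces over `C ∖ W` are null.
[Kontsevich–Zagier 2001, §1.2; this work] -/
theorem soloInformed_of_sub_of_mem_scissorsRel_cell {l : ℕ} {S : Set (Fin (m + 1) → ℝ)}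
    (hS : IsSemialgebraic ℚ S) (hfin : volume S ≠ ⊤) {C : Set (Fin m → ℝ)}
    (hC : IsSemialgebraic ℚ C) (ξ : Fin l → (Fin m → ℝ) → ℝ)
    (hξ : ∀ i, IsSemialgebraicFunOn ℚ C (ξ i)) (hmono : ∀ x ∈ C, StrictMono fun i => ξ i x)
    (G : Finset (Fin l)) (B : Finset (Fin (l + 1))) (hBsub : ∀ j ∈ B, bandOver C ξ j ⊆ S)
    (hBsa : ∀ j, IsSemialgebraic ℚ (bandOver C ξ j))
    (hfib : ∀ x ∈ C, {t : ℝ | (Fin.snoc x t : Fin (m + 1) → ℝ) ∈ S} = (⋃ j ∈ G, {ξ j x}) ∪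
      ⋃ j ∈ B, {t : ℝ | bandLower ξ j x < (t : EReal) ∧ (t : EReal) < bandUpper ξ j x})
    (r r' : IntegralRep (m + 1)) (hrd : r.domain = S ∩ {z | Fin.init z ∈ C})
    (hr1 : SoloInformedIsVolRep r)
    (hr'd : r'.domain = Grounding.groundLast S ∩ {z | Fin.init z ∈ C})
    (hr'1 : SoloInformedIsVolRep r') : of r - of r' ∈ soloInformedScissorsRel := by
  classical
  -- the common smooth locus `W` of the sections (and an open null-complement subset of `C`)
  have hz0 : IsSemialgebraicFunOn ℚ C fun _ => (0 : ℝ) := by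
    simpa using isSemialgebraicFunOn_ratCast hC 0
  obtain ⟨G₀, hG₀C, hG₀o, hG₀sa, -, -, hG₀null⟩ := exists_isOpen_contDiffOn hC hz0
  have hGi : ∀ i : Fin l, ∃ Gi : Set (Fin m → ℝ), Gi ⊆ C ∧ IsOpen Gi ∧ IsSemialgebraic ℚ Gi ∧
      ContDiffOn ℝ ∞ (ξ i) Gi ∧ IsSemialgebraic ℚ (C \ Gi) ∧ volume (C \ Gi) = 0 := fun i =>
    exists_isOpen_contDiffOn hC (hξ i)
  choose Gi hGiC hGio hGisa hGism hGid hGinull using hGi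
  set W : Set (Fin m → ℝ) := G₀ ∩ ⋂ i ∈ (Finset.univ : Finset (Fin l)), Gi i with hW
  have hWC : W ⊆ C := inter_subset_left.trans hG₀C
  have hWo : IsOpen W := hG₀o.inter (isOpen_biInter_finset fun i _ => hGio i)
  have hWsa : IsSemialgebraic ℚ W :=
    hG₀sa.inter (soloInformed_isSemialgebraic_biInter_finset Finset.univ fun i _ => hGisa i)
  have hWi : ∀ i, W ⊆ Gi i := fun i =>
    inter_subset_right.trans (biInter_subset_of_mem (Finset.mem_coe.2 (Finset.mem_univ i)))
  have hCW : volume (C \ W) = 0 := by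
    have hsub : C \ W ⊆ (C \ G₀) ∪ ⋃ i ∈ (Finset.univ : Finset (Fin l)), (C \ Gi i) := by
      intro x hx
      obtain ⟨hxC, hxW⟩ := hx
      by_cases h0 : x ∈ G₀
      · right
        have : ¬ ∀ i ∈ (Finset.univ : Finset (Fin l)), x ∈ Gi i := fun h =>
          hxW ⟨h0, mem_iInter₂.2 h⟩
        push Not at this
        obtain ⟨i, -, hi⟩ := this
        exact mem_iUnion₂.2 ⟨i, Finset.mem_univ i, hxC, hi⟩
      · exact Or.inl ⟨hxC, h0⟩
    exact measure_mono_null hsub (measure_union_null hG₀null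
      ((measure_biUnion_null_iff (Finset.univ : Finset (Fin l)).countable_toSet).2
        fun i _ => hGinull i))
  -- restrict `r`, `r'` to the cylinder over `W`
  have hcylW : IsSemialgebraic ℚ {z : Fin (m + 1) → ℝ | Fin.init z ∈ W} := hWsa.setOf_init_mem
  have hnullcyl := volume_setOf_init_mem_eq_zero (n := m) hCW
  set rW : IntegralRep (m + 1) := r.restrict (r.domain ∩ {z | Fin.init z ∈ W})
    (r.isSemialgebraic_domain.inter hcylW) inter_subset_left with hrW_def
  set rW' : IntegralRep (m + 1) := r'.restrict (r'.domain ∩ {z | Fin.init z ∈ W})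
    (r'.isSemialgebraic_domain.inter hcylW) inter_subset_left with hrW'_def
  have hrWv : SoloInformedIsVolRep rW := fun x hx => hr1 x hx.1
  have hrW'v : SoloInformedIsVolRep rW' := fun x hx => hr'1 x hx.1
  have er : of r - of rW ∈ soloInformedScissorsRel := by
    refine soloInformed_of_sub_of_mem_scissorsRel_of_subset hr1 hrWv inter_subset_left
      (measure_mono_null (fun z hz => ?_) hnullcyl)
    obtain ⟨hz, hz'⟩ := hz
    have hzC : Fin.init z ∈ C := by
      have h := hz; rw [hrd] at h; exact h.2
    exact ⟨hzC, fun hzW => hz' ⟨hz, hzW⟩⟩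
  have er' : of r' - of rW' ∈ soloInformedScissorsRel := by
    refine soloInformed_of_sub_of_mem_scissorsRel_of_subset hr'1 hrW'v inter_subset_left
      (measure_mono_null (fun z hz => ?_) hnullcyl)
    obtain ⟨hz, hz'⟩ := hz
    have hzC : Fin.init z ∈ C := by
      have h := hz; rw [hr'd] at h; exact h.2
    exact ⟨hzC, fun hzW => hz' ⟨hz, hzW⟩⟩
  -- the smooth-cell case over `W`
  have ecell : of rW - of rW' ∈ soloInformedScissorsRel := by
    refine soloInformed_of_sub_of_mem_scissorsRel_smoothCell hS hfin hWsa hWo ξ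
      (fun i => (hξ i).mono hWC hWsa) (fun i => (hGism i).mono (hWi i))
      (fun x hx => hmono x (hWC hx)) G B (fun j hj z hz => hBsub j hj ?_) (fun j => ?_)
      (fun x hx => hfib x (hWC hx)) rW rW' ?_ hrWv ?_ hrW'v
    · rw [mem_bandOver_iff] at hz ⊢
      exact ⟨hWC hz.1, hz.2⟩
    · have : bandOver W ξ j = bandOver C ξ j ∩ {z | Fin.init z ∈ W} := by
        ext z
        simp only [mem_bandOver_iff, mem_inter_iff, mem_setOf_eq]
        constructor
        · rintro ⟨hW', h1, h2⟩
          exact ⟨⟨hWC hW', h1, h2⟩, hW'⟩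
        · rintro ⟨⟨-, h1, h2⟩, hW'⟩
          exact ⟨hW', h1, h2⟩
      rw [this]
      exact (hBsa j).inter hcylW
    · show r.domain ∩ {z | Fin.init z ∈ W} = S ∩ {z | Fin.init z ∈ W}
      rw [hrd]
      ext z
      simp only [mem_inter_iff, mem_setOf_eq]
      constructor
      · rintro ⟨⟨hS', -⟩, hW'⟩
        exact ⟨hS', hW'⟩
      · rintro ⟨hS', hW'⟩
        exact ⟨⟨hS', hWC hW'⟩, hW'⟩
    · show r'.domain ∩ {z | Fin.init z ∈ W} = Grounding.groundLast S ∩ {z | Fin.init z ∈ W}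
      rw [hr'd]
      ext z
      simp only [mem_inter_iff, mem_setOf_eq]
      constructor
      · rintro ⟨⟨hS', -⟩, hW'⟩
        exact ⟨hS', hW'⟩
      · rintro ⟨hS', hW'⟩
        exact ⟨⟨hS', hWC hW'⟩, hW'⟩
  have : of r - of r' = (of r - of rW) + (of rW - of rW') - (of r' - of rW') := by abel
  rw [this]
  exact sub_mem (add_mem er ecell) er'

/-! ### Grounding the last coordinate, any coordinate, all coordinates — in `𝒮` -/

/-- **Grounding the last coordinate is a chain of `𝒮`-moves.** For volume representations
`r = (S, 1)` and `r' = (groundLast S, 1)`, `[r] − [r'] ∈ 𝒮`: cut both along the cylinders over the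
cells of a cylindrical decomposition of `ℝ^m` adapted to `S` and treat each cell by
`soloInformed_of_sub_of_mem_scissorsRel_cell`. [Kontsevich–Zagier 2001, §1.2; Basu–Pollack–Roy 2006,
Cor. 5.7; this work] -/
theorem soloInformed_of_sub_of_mem_scissorsRel_groundLast (r r' : IntegralRep (m + 1))
    (h1 : SoloInformedIsVolRep r) (hd : r'.domain = Grounding.groundLast r.domain)
    (h1' : SoloInformedIsVolRep r') : of r - of r' ∈ soloInformedScissorsRel := by
  classical
  have hS : IsSemialgebraic ℚ r.domain := r.isSemialgebraic_domain
  have hfin : volume r.domain ≠ ⊤ := volume_ne_top_of_integrand_one r h1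
  obtain ⟨P, l, ξ, hcd, -, hξ, hmono, hcells, hfib⟩ :=
    IsSemialgebraic.exists_cylindricalDecomposition.exists_fibre_eq
      (IsSemialgebraic.exists_cylindricalDecomposition_holds (k := ℚ)) hS
  have hpart := hcd.isPartition
  have hPsa := hcd.isSemialgebraic
  let R : {C // C ∈ P} → IntegralRep (m + 1) := fun C =>
    r.restrict (r.domain ∩ {z | Fin.init z ∈ (C : Set (Fin m → ℝ))})
      (hS.inter (hPsa C C.2).setOf_init_mem) inter_subset_left
  let R' : {C // C ∈ P} → IntegralRep (m + 1) := fun C =>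
    r'.restrict (r'.domain ∩ {z | Fin.init z ∈ (C : Set (Fin m → ℝ))})
      (r'.isSemialgebraic_domain.inter (hPsa C C.2).setOf_init_mem) inter_subset_left
  have hRv : ∀ C, SoloInformedIsVolRep (R C) := fun C x hx => h1 x hx.1
  have hR'v : ∀ C, SoloInformedIsVolRep (R' C) := fun C x hx => h1' x hx.1
  have eR : of r - ∑ C ∈ P.attach, of (R C) ∈ soloInformedScissorsRel :=
    soloInformed_of_sub_sum_cyl_mem_scissorsRel r h1 P hpart R hRv fun C => rfl
  have eR' : of r' - ∑ C ∈ P.attach, of (R' C) ∈ soloInformedScissorsRel :=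
    soloInformed_of_sub_sum_cyl_mem_scissorsRel r' h1' P hpart R' hR'v fun C => rfl
  have ecell : ∀ C : {C // C ∈ P}, of (R C) - of (R' C) ∈ soloInformedScissorsRel := by
    intro C
    obtain ⟨G, B, -, hBsub, hfibC⟩ := hfib C C.2
    exact soloInformed_of_sub_of_mem_scissorsRel_cell hS hfin (hPsa C C.2) (ξ C) (hξ C C.2)
      (hmono C C.2) G B hBsub (hcells C C.2).2 hfibC (R C) (R' C) rfl (hRv C) (by rw [← hd]; rfl)
      (hR'v C)
  have esum : ∑ C ∈ P.attach, of (R C) - ∑ C ∈ P.attach, of (R' C) ∈ soloInformedScissorsRel :=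
    soloInformed_sum_sub_sum_mem_scissorsRel _ _ _ fun C _ => ecell C
  have : of r - of r' = (of r - ∑ C ∈ P.attach, of (R C)) +
      (∑ C ∈ P.attach, of (R C) - ∑ C ∈ P.attach, of (R' C)) -
      (of r' - ∑ C ∈ P.attach, of (R' C)) := by abel
  rw [this]
  exact sub_mem (add_mem eR esum) eR'

/-- **Grounding any coordinate is a chain of `𝒮`-moves** (`groundAt i` is `groundLast` conjugated
by the transposition `(i last)`, and coordinate permutations are `𝒮`-moves).
[Kontsevich–Zagier 2001, §1.2; this work] -/
theorem soloInformed_of_sub_of_mem_scissorsRel_groundAt (i : Fin (m + 1)) (r r' : IntegralRep (m + 1))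
    (h1 : SoloInformedIsVolRep r) (hd : r'.domain = Grounding.groundAt i r.domain)
    (h1' : SoloInformedIsVolRep r') : of r - of r' ∈ soloInformedScissorsRel := by
  set σ := Equiv.swap i (Fin.last m) with hσ
  have hS : IsSemialgebraic ℚ r.domain := r.isSemialgebraic_domain
  have hSm : MeasurableSet r.domain := IntegralRep.measurableSet_domain_holds r
  have hfin : volume r.domain ≠ ⊤ := volume_ne_top_of_integrand_one r h1
  have hT₁ : IsSemialgebraic ℚ (Grounding.perm σ r.domain) := Grounding.isSemialgebraic_perm σ hS
  have hT₁m : MeasurableSet (Grounding.perm σ r.domain) := IsSemialgebraic.measurableSet_holds hT₁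
  have hT₁v : volume (Grounding.perm σ r.domain) ≠ ⊤ := by rwa [Grounding.volume_perm σ hSm]
  obtain ⟨r₁, hr₁d, hr₁i⟩ := exists_oneRep hT₁ hT₁v
  have hT₂ : IsSemialgebraic ℚ (Grounding.groundLast (Grounding.perm σ r.domain)) :=
    Grounding.isSemialgebraic_groundLast hT₁
  have hT₂v : volume (Grounding.groundLast (Grounding.perm σ r.domain)) ≠ ⊤ := by
    rwa [Grounding.volume_groundLast hT₁m (IsSemialgebraic.measurableSet_holds hT₂)]
  obtain ⟨r₂, hr₂d, hr₂i⟩ := exists_oneRep hT₂ hT₂v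
  have hr₁v : SoloInformedIsVolRep r₁ := fun x _ => by rw [hr₁i]
  have hr₂v : SoloInformedIsVolRep r₂ := fun x _ => by rw [hr₂i]
  have e1 : of r - of r₁ ∈ soloInformedScissorsRel :=
    soloInformed_of_sub_of_mem_scissorsRel_perm σ r r₁ h1 hr₁d hr₁v
  have e2 : of r₁ - of r₂ ∈ soloInformedScissorsRel :=
    soloInformed_of_sub_of_mem_scissorsRel_groundLast r₁ r₂ hr₁v (by rw [hr₂d, hr₁d]) hr₂v
  have e3 : of r₂ - of r' ∈ soloInformedScissorsRel :=
    soloInformed_of_sub_of_mem_scissorsRel_perm σ r₂ r' hr₂v (by rw [hd, hr₂d]; rfl) h1'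
  have : of r - of r' = (of r - of r₁) + (of r₁ - of r₂) + (of r₂ - of r') := by abel
  rw [this]
  exact add_mem (add_mem e1 e2) e3

/-- **Grounding the coordinates one after the other is a chain of `𝒮`-moves.**
[Kontsevich–Zagier 2001, §1.2; this work] -/
theorem soloInformed_of_sub_of_mem_scissorsRel_groundIter (k : ℕ) :
    ∀ r r' : IntegralRep (m + 1), SoloInformedIsVolRep r →
      r'.domain = Grounding.groundIter r.domain k → SoloInformedIsVolRep r' →
      of r - of r' ∈ soloInformedScissorsRel := by
  induction k with
  | zero =>
    intro r r' h1 hd h1'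
    exact soloInformed_of_sub_of_mem_scissorsRel_of_domain_eq h1 h1' (by rw [hd]; rfl)
  | succ k ih =>
    intro r r' h1 hd h1'
    obtain ⟨hk, hkv, -⟩ := Grounding.groundIter_spec r.isSemialgebraic_domain k
    have hfin : volume (Grounding.groundIter r.domain k) ≠ ⊤ := by
      rw [hkv]; exact volume_ne_top_of_integrand_one r h1
    obtain ⟨rk, hrkd, hrki⟩ := exists_oneRep hk hfin
    have hrkv : SoloInformedIsVolRep rk := fun x _ => by rw [hrki]
    have e1 : of r - of rk ∈ soloInformedScissorsRel := ih r rk h1 hrkd hrkv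
    have e2 : of rk - of r' ∈ soloInformedScissorsRel := by
      by_cases h : k < m + 1
      · refine soloInformed_of_sub_of_mem_scissorsRel_groundAt ⟨k, h⟩ rk r' hrkv ?_ h1'
        rw [hd, hrkd, Grounding.groundIter, dif_pos h]
      · have hdom : r'.domain = rk.domain := by rw [hd, hrkd, Grounding.groundIter, dif_neg h]
        exact soloInformed_of_sub_of_mem_scissorsRel_of_domain_eq hrkv h1' hdom.symm
    have : of r - of r' = (of r - of rk) + (of rk - of r') := by abel
    rw [this]
    exact add_mem e1 e2

/-- **Every volume representation is scissors congruent to a down-set.** For a volume representation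
`A` of dimension `m + 1` there is a volume representation `D` whose domain is a `ℚ`-semialgebraic
subset of the open positive orthant that is a down-set for the coordinatewise order, with
`[A] − [D] ∈ 𝒮`: `D` is the grounding of `A.domain` in all coordinates. This is the `𝒮`-version
(no Newton–Leibniz rule, no change of dimension) of `KZ.exists_downset_sub_mem_relations`.
[this work, nl-elimination.md NF.4(3)] -/
theorem soloInformed_exists_downset_sub_mem_scissorsRel (A : IntegralRep (m + 1))
    (hA : SoloInformedIsVolRep A) :
    ∃ D : IntegralRep (m + 1), (∀ x ∈ D.domain, ∀ i, 0 < x i) ∧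
      (∀ x ∈ D.domain, ∀ y : Fin (m + 1) → ℝ, (∀ i, 0 < y i ∧ y i ≤ x i) → y ∈ D.domain) ∧
      SoloInformedIsVolRep D ∧ of A - of D ∈ soloInformedScissorsRel := by
  obtain ⟨hsa, hvol, hspec⟩ := Grounding.groundIter_spec A.isSemialgebraic_domain (m + 1)
  have hfin : volume (Grounding.groundIter A.domain (m + 1)) ≠ ⊤ := by
    rw [hvol]; exact volume_ne_top_of_integrand_one A hA
  obtain ⟨D, hDd, hDi⟩ := exists_oneRep hsa hfin
  have hDv : SoloInformedIsVolRep D := fun x _ => by rw [hDi]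
  refine ⟨D, fun x hx i => ?_, fun x hx y hy => ?_, hDv,
    soloInformed_of_sub_of_mem_scissorsRel_groundIter (m + 1) A D hA hDd hDv⟩
  · rw [hDd] at hx
    exact (hspec i i.isLt).1 x hx
  · rw [hDd] at hx ⊢
    exact Grounding.mem_of_forall_update_mem (fun i => (hspec i i.isLt).2) hx hy

end Summit.KontsevichZagierPeriods.KontsevichZagierPeriods.Theorems

end
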